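import Summits.CriticalPhenomena.PercolationContinuityZ3.Theorems.PercNearOneGluingNoHeavyLowerTailTwoPortPeelingLevelTwoIffsCPort
import Summits.CriticalPhenomena.PercolationContinuityZ3.Theorems.PercNearOneGluingNoHeavyLowerTailTwoPortPeelingLevelTwoAssembly
import Summits.CriticalPhenomena.PercolationContinuityZ3.Theorems.PercNearOneGluingNoHeavyLowerTailTwoPortPeelingCPortPointwise
import HarnessLib

/-!
# `NoHeavyLowerTail` (stmt-CriticalPhenomena-4575) — two-port peeling, champion at a port: the certificate integrated (level `j ≤ 2`)

Route `PercNearOneGluingNoHeavy`, seat `prim-gen-swap` (gen 5); memo TWO-PORT-PEELING.md §9 (A).  For `u = {c, a'}` (bond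
weights `a_c = w(uc)`, `a' = w(ua')`), `v = {b, b'}` (`θ_v = w(vb)w(vb')`), hubs outside `A` carrying no other open pair, ports
pairwise distinct, `j ≤ 2`: if `c` beats `a'`, `b`, `b'` as an observer then
`0 ≤ (1 − a_c a')·[(1 − a')·h00 + a'·h01]`, the measure form of `E[Z]` (`cport_nonneg_levelTwo`).  Proof as in
`comonotone_nonneg_levelTwo`: pull every world back to the base measure, expand the champion rows by the relay law at both
hubs, integrate `cport_pointwise_abstract` fed with the level-2 translations.  No definitions, no named facts, no sorries.
-/

noncomputable section

namespace Summit.CriticalPhenomena.PercolationContinuityZ3.Theorems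

open MeasureTheory Set Literature.Probability.LatticeModels Literature.Probability.Percolation
open scoped Classical BigOperators

variable {n : ℕ}

namespace TwoPortPeeling

/-- The champion-at-a-port certificate at a configuration whose hubs are isolated (list form, multiplied by `1 − τ` and
with the full champion row of `a'`). [this file] -/
theorem cport_certificate_at (w : Sym2 (Fin n) → unitInterval) (A : Finset (Fin n))
    (u v c a' b b' : Fin n) (j : ℕ) (hj : j ≤ 2) (hu : u ∉ A) (hv : v ∉ A) (huv : u ≠ v)
    (hc : c ∈ A) (ha' : a' ∈ A) (hb : b ∈ A) (hb' : b' ∈ A)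
    (hca' : c ≠ a') (hcb : c ≠ b) (hcb' : c ≠ b') (ha'b : a' ≠ b) (ha'b' : a' ≠ b') (hbb' : b ≠ b') (ω : BondConfig (Fin n))
    (hisoU : ∀ y : Fin n, y ≠ u → s(u, y) ∉ ω) (hisoV : ∀ y : Fin n, y ≠ v → s(v, y) ∉ ω) :
    0 ≤ (([(((1 - ((w s(u, c) : ℝ) * (w s(u, a') : ℝ))) * ((1 - (w s(u, a') : ℝ)) * (1 - ((w s(v, b) : ℝ) * w s(v, b'))))), {ω : BondConfig (Fin n) | (A.filter fun z => ω ∈ openConn c z).card ≤ j}),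
      ((-((1 - ((w s(u, c) : ℝ) * (w s(u, a') : ℝ))) * ((1 - (w s(u, a') : ℝ)) * (1 - ((w s(v, b) : ℝ) * w s(v, b')))))), {ω : BondConfig (Fin n) | 1 ≤ (A.filter fun z => ω ∈ openConn u z).card ∧ (A.filter fun z => ω ∈ openConn u z).card ≤ j}),
      (((1 - ((w s(u, c) : ℝ) * (w s(u, a') : ℝ))) * ((1 - (w s(u, a') : ℝ)) * ((w s(v, b) : ℝ) * w s(v, b')))), ((fun ω : BondConfig (Fin n) => insert s(v, b) (insert s(v, b') ω)) ⁻¹' {ω : BondConfig (Fin n) | ω ∉ openConn c u ∧ ω ∉ openConn c v ∧ (A.filter fun z => ω ∈ openConn c z).card ≤ j})),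
      ((-((1 - ((w s(u, c) : ℝ) * (w s(u, a') : ℝ))) * ((1 - (w s(u, a') : ℝ)) * ((w s(v, b) : ℝ) * w s(v, b'))))), ((fun ω : BondConfig (Fin n) => insert s(v, b) (insert s(v, b') ω)) ⁻¹' {ω : BondConfig (Fin n) | ω ∉ openConn c u ∧ ω ∉ openConn c v ∧ 1 ≤ (A.filter fun z => ω ∈ openConn u z ∨ ω ∈ openConn v z).card ∧ (A.filter fun z => ω ∈ openConn u z ∨ ω ∈ openConn v z).card ≤ j})),
      (((1 - ((w s(u, c) : ℝ) * (w s(u, a') : ℝ))) * ((w s(u, a') : ℝ) * (1 - ((w s(v, b) : ℝ) * w s(v, b'))))), ((fun ω : BondConfig (Fin n) => insert s(u, a') ω) ⁻¹' {ω : BondConfig (Fin n) | (A.filter fun z => ω ∈ openConn c z).card ≤ j})),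
      ((-((1 - ((w s(u, c) : ℝ) * (w s(u, a') : ℝ))) * ((w s(u, a') : ℝ) * (1 - ((w s(v, b) : ℝ) * w s(v, b')))))), ((fun ω : BondConfig (Fin n) => insert s(u, a') ω) ⁻¹' {ω : BondConfig (Fin n) | 1 ≤ (A.filter fun z => ω ∈ openConn u z).card ∧ (A.filter fun z => ω ∈ openConn u z).card ≤ j})),
      (((1 - ((w s(u, c) : ℝ) * (w s(u, a') : ℝ))) * ((w s(u, a') : ℝ) * ((w s(v, b) : ℝ) * w s(v, b')))), ((fun ω : BondConfig (Fin n) => insert s(u, a') (insert s(v, b) (insert s(v, b') ω))) ⁻¹' {ω : BondConfig (Fin n) | ω ∉ openConn c u ∧ ω ∉ openConn c v ∧ (A.filter fun z => ω ∈ openConn c z).card ≤ j})),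
      ((-((1 - ((w s(u, c) : ℝ) * (w s(u, a') : ℝ))) * ((w s(u, a') : ℝ) * ((w s(v, b) : ℝ) * w s(v, b'))))), ((fun ω : BondConfig (Fin n) => insert s(u, a') (insert s(v, b) (insert s(v, b') ω))) ⁻¹' {ω : BondConfig (Fin n) | ω ∉ openConn c u ∧ ω ∉ openConn c v ∧ 1 ≤ (A.filter fun z => ω ∈ openConn u z ∨ ω ∈ openConn v z).card ∧ (A.filter fun z => ω ∈ openConn u z ∨ ω ∈ openConn v z).card ≤ j})),
      ((-((w s(u, a') : ℝ) * ((1 - ((w s(u, c) : ℝ) * (w s(u, a') : ℝ))) * (1 - ((w s(v, b) : ℝ) * w s(v, b')))))), {ω : BondConfig (Fin n) | (A.filter fun z => ω ∈ openConn c z).card ≤ j}),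
      (((w s(u, a') : ℝ) * ((1 - ((w s(u, c) : ℝ) * (w s(u, a') : ℝ))) * (1 - ((w s(v, b) : ℝ) * w s(v, b'))))), {ω : BondConfig (Fin n) | (A.filter fun z => ω ∈ openConn a' z).card ≤ j}),
      ((-((w s(u, a') : ℝ) * ((1 - ((w s(u, c) : ℝ) * (w s(u, a') : ℝ))) * ((w s(v, b) : ℝ) * w s(v, b'))))), ((fun ω : BondConfig (Fin n) => insert s(v, b) (insert s(v, b') ω)) ⁻¹' {ω : BondConfig (Fin n) | (A.filter fun z => ω ∈ openConn c z).card ≤ j})),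
      (((w s(u, a') : ℝ) * ((1 - ((w s(u, c) : ℝ) * (w s(u, a') : ℝ))) * ((w s(v, b) : ℝ) * w s(v, b')))), ((fun ω : BondConfig (Fin n) => insert s(v, b) (insert s(v, b') ω)) ⁻¹' {ω : BondConfig (Fin n) | (A.filter fun z => ω ∈ openConn a' z).card ≤ j})),
      ((-((w s(u, a') : ℝ) * (((w s(u, c) : ℝ) * (w s(u, a') : ℝ)) * (1 - ((w s(v, b) : ℝ) * w s(v, b')))))), ((fun ω : BondConfig (Fin n) => insert s(u, c) (insert s(u, a') ω)) ⁻¹' {ω : BondConfig (Fin n) | (A.filter fun z => ω ∈ openConn c z).card ≤ j})),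
      (((w s(u, a') : ℝ) * (((w s(u, c) : ℝ) * (w s(u, a') : ℝ)) * (1 - ((w s(v, b) : ℝ) * w s(v, b'))))), ((fun ω : BondConfig (Fin n) => insert s(u, c) (insert s(u, a') ω)) ⁻¹' {ω : BondConfig (Fin n) | (A.filter fun z => ω ∈ openConn a' z).card ≤ j})),
      ((-((w s(u, a') : ℝ) * (((w s(u, c) : ℝ) * (w s(u, a') : ℝ)) * ((w s(v, b) : ℝ) * w s(v, b'))))), ((fun ω : BondConfig (Fin n) => insert s(u, c) (insert s(u, a') (insert s(v, b) (insert s(v, b') ω)))) ⁻¹' {ω : BondConfig (Fin n) | (A.filter fun z => ω ∈ openConn c z).card ≤ j})),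
      (((w s(u, a') : ℝ) * (((w s(u, c) : ℝ) * (w s(u, a') : ℝ)) * ((w s(v, b) : ℝ) * w s(v, b')))), ((fun ω : BondConfig (Fin n) => insert s(u, c) (insert s(u, a') (insert s(v, b) (insert s(v, b') ω)))) ⁻¹' {ω : BondConfig (Fin n) | (A.filter fun z => ω ∈ openConn a' z).card ≤ j})),
      ((-((1 - ((w s(u, c) : ℝ) * (w s(u, a') : ℝ))) * (((w s(v, b) : ℝ) * w s(v, b')) * (1 - (w s(u, a') : ℝ)) / 2) * ((1 - ((w s(u, c) : ℝ) * (w s(u, a') : ℝ))) * (1 - ((w s(v, b) : ℝ) * w s(v, b')))))), {ω : BondConfig (Fin n) | (A.filter fun z => ω ∈ openConn c z).card ≤ j}),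
      (((1 - ((w s(u, c) : ℝ) * (w s(u, a') : ℝ))) * (((w s(v, b) : ℝ) * w s(v, b')) * (1 - (w s(u, a') : ℝ)) / 2) * ((1 - ((w s(u, c) : ℝ) * (w s(u, a') : ℝ))) * (1 - ((w s(v, b) : ℝ) * w s(v, b'))))), {ω : BondConfig (Fin n) | (A.filter fun z => ω ∈ openConn b z).card ≤ j}),
      ((-((1 - ((w s(u, c) : ℝ) * (w s(u, a') : ℝ))) * (((w s(v, b) : ℝ) * w s(v, b')) * (1 - (w s(u, a') : ℝ)) / 2) * ((1 - ((w s(u, c) : ℝ) * (w s(u, a') : ℝ))) * ((w s(v, b) : ℝ) * w s(v, b'))))), ((fun ω : BondConfig (Fin n) => insert s(v, b) (insert s(v, b') ω)) ⁻¹' {ω : BondConfig (Fin n) | (A.filter fun z => ω ∈ openConn c z).card ≤ j})),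
      (((1 - ((w s(u, c) : ℝ) * (w s(u, a') : ℝ))) * (((w s(v, b) : ℝ) * w s(v, b')) * (1 - (w s(u, a') : ℝ)) / 2) * ((1 - ((w s(u, c) : ℝ) * (w s(u, a') : ℝ))) * ((w s(v, b) : ℝ) * w s(v, b')))), ((fun ω : BondConfig (Fin n) => insert s(v, b) (insert s(v, b') ω)) ⁻¹' {ω : BondConfig (Fin n) | (A.filter fun z => ω ∈ openConn b z).card ≤ j})),
      ((-((1 - ((w s(u, c) : ℝ) * (w s(u, a') : ℝ))) * (((w s(v, b) : ℝ) * w s(v, b')) * (1 - (w s(u, a') : ℝ)) / 2) * (((w s(u, c) : ℝ) * (w s(u, a') : ℝ)) * (1 - ((w s(v, b) : ℝ) * w s(v, b')))))), ((fun ω : BondConfig (Fin n) => insert s(u, c) (insert s(u, a') ω)) ⁻¹' {ω : BondConfig (Fin n) | (A.filter fun z => ω ∈ openConn c z).card ≤ j})),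
      (((1 - ((w s(u, c) : ℝ) * (w s(u, a') : ℝ))) * (((w s(v, b) : ℝ) * w s(v, b')) * (1 - (w s(u, a') : ℝ)) / 2) * (((w s(u, c) : ℝ) * (w s(u, a') : ℝ)) * (1 - ((w s(v, b) : ℝ) * w s(v, b'))))), ((fun ω : BondConfig (Fin n) => insert s(u, c) (insert s(u, a') ω)) ⁻¹' {ω : BondConfig (Fin n) | (A.filter fun z => ω ∈ openConn b z).card ≤ j})),
      ((-((1 - ((w s(u, c) : ℝ) * (w s(u, a') : ℝ))) * (((w s(v, b) : ℝ) * w s(v, b')) * (1 - (w s(u, a') : ℝ)) / 2) * (((w s(u, c) : ℝ) * (w s(u, a') : ℝ)) * ((w s(v, b) : ℝ) * w s(v, b'))))), ((fun ω : BondConfig (Fin n) => insert s(u, c) (insert s(u, a') (insert s(v, b) (insert s(v, b') ω)))) ⁻¹' {ω : BondConfig (Fin n) | (A.filter fun z => ω ∈ openConn c z).card ≤ j})),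
      (((1 - ((w s(u, c) : ℝ) * (w s(u, a') : ℝ))) * (((w s(v, b) : ℝ) * w s(v, b')) * (1 - (w s(u, a') : ℝ)) / 2) * (((w s(u, c) : ℝ) * (w s(u, a') : ℝ)) * ((w s(v, b) : ℝ) * w s(v, b')))), ((fun ω : BondConfig (Fin n) => insert s(u, c) (insert s(u, a') (insert s(v, b) (insert s(v, b') ω)))) ⁻¹' {ω : BondConfig (Fin n) | (A.filter fun z => ω ∈ openConn b z).card ≤ j})),
      ((-((1 - ((w s(u, c) : ℝ) * (w s(u, a') : ℝ))) * (((w s(v, b) : ℝ) * w s(v, b')) * (1 - (w s(u, a') : ℝ)) / 2) * ((1 - ((w s(u, c) : ℝ) * (w s(u, a') : ℝ))) * (1 - ((w s(v, b) : ℝ) * w s(v, b')))))), {ω : BondConfig (Fin n) | (A.filter fun z => ω ∈ openConn c z).card ≤ j}),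
      (((1 - ((w s(u, c) : ℝ) * (w s(u, a') : ℝ))) * (((w s(v, b) : ℝ) * w s(v, b')) * (1 - (w s(u, a') : ℝ)) / 2) * ((1 - ((w s(u, c) : ℝ) * (w s(u, a') : ℝ))) * (1 - ((w s(v, b) : ℝ) * w s(v, b'))))), {ω : BondConfig (Fin n) | (A.filter fun z => ω ∈ openConn b' z).card ≤ j}),
      ((-((1 - ((w s(u, c) : ℝ) * (w s(u, a') : ℝ))) * (((w s(v, b) : ℝ) * w s(v, b')) * (1 - (w s(u, a') : ℝ)) / 2) * ((1 - ((w s(u, c) : ℝ) * (w s(u, a') : ℝ))) * ((w s(v, b) : ℝ) * w s(v, b'))))), ((fun ω : BondConfig (Fin n) => insert s(v, b) (insert s(v, b') ω)) ⁻¹' {ω : BondConfig (Fin n) | (A.filter fun z => ω ∈ openConn c z).card ≤ j})),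
      (((1 - ((w s(u, c) : ℝ) * (w s(u, a') : ℝ))) * (((w s(v, b) : ℝ) * w s(v, b')) * (1 - (w s(u, a') : ℝ)) / 2) * ((1 - ((w s(u, c) : ℝ) * (w s(u, a') : ℝ))) * ((w s(v, b) : ℝ) * w s(v, b')))), ((fun ω : BondConfig (Fin n) => insert s(v, b) (insert s(v, b') ω)) ⁻¹' {ω : BondConfig (Fin n) | (A.filter fun z => ω ∈ openConn b' z).card ≤ j})),
      ((-((1 - ((w s(u, c) : ℝ) * (w s(u, a') : ℝ))) * (((w s(v, b) : ℝ) * w s(v, b')) * (1 - (w s(u, a') : ℝ)) / 2) * (((w s(u, c) : ℝ) * (w s(u, a') : ℝ)) * (1 - ((w s(v, b) : ℝ) * w s(v, b')))))), ((fun ω : BondConfig (Fin n) => insert s(u, c) (insert s(u, a') ω)) ⁻¹' {ω : BondConfig (Fin n) | (A.filter fun z => ω ∈ openConn c z).card ≤ j})),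
      (((1 - ((w s(u, c) : ℝ) * (w s(u, a') : ℝ))) * (((w s(v, b) : ℝ) * w s(v, b')) * (1 - (w s(u, a') : ℝ)) / 2) * (((w s(u, c) : ℝ) * (w s(u, a') : ℝ)) * (1 - ((w s(v, b) : ℝ) * w s(v, b'))))), ((fun ω : BondConfig (Fin n) => insert s(u, c) (insert s(u, a') ω)) ⁻¹' {ω : BondConfig (Fin n) | (A.filter fun z => ω ∈ openConn b' z).card ≤ j})),
      ((-((1 - ((w s(u, c) : ℝ) * (w s(u, a') : ℝ))) * (((w s(v, b) : ℝ) * w s(v, b')) * (1 - (w s(u, a') : ℝ)) / 2) * (((w s(u, c) : ℝ) * (w s(u, a') : ℝ)) * ((w s(v, b) : ℝ) * w s(v, b'))))), ((fun ω : BondConfig (Fin n) => insert s(u, c) (insert s(u, a') (insert s(v, b) (insert s(v, b') ω)))) ⁻¹' {ω : BondConfig (Fin n) | (A.filter fun z => ω ∈ openConn c z).card ≤ j})),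
      (((1 - ((w s(u, c) : ℝ) * (w s(u, a') : ℝ))) * (((w s(v, b) : ℝ) * w s(v, b')) * (1 - (w s(u, a') : ℝ)) / 2) * (((w s(u, c) : ℝ) * (w s(u, a') : ℝ)) * ((w s(v, b) : ℝ) * w s(v, b')))), ((fun ω : BondConfig (Fin n) => insert s(u, c) (insert s(u, a') (insert s(v, b) (insert s(v, b') ω)))) ⁻¹' {ω : BondConfig (Fin n) | (A.filter fun z => ω ∈ openConn b' z).card ≤ j}))] : List (ℝ × Set (BondConfig (Fin n)))).map
      fun ce => ce.1 * ce.2.indicator (1 : BondConfig (Fin n) → ℝ) ω).sum := by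
  have hp0 : 0 ≤ (w s(u, c) : ℝ) := (w s(u, c)).2.1
  have hp1 : (w s(u, c) : ℝ) ≤ 1 := (w s(u, c)).2.2
  have hq0 : 0 ≤ (w s(u, a') : ℝ) := (w s(u, a')).2.1
  have hq1 : (w s(u, a') : ℝ) ≤ 1 := (w s(u, a')).2.2
  have hs0 : 0 ≤ ((w s(v, b) : ℝ) * w s(v, b')) := mul_nonneg (w s(v, b)).2.1 (w s(v, b')).2.1
  have hs1 : ((w s(v, b) : ℝ) * w s(v, b')) ≤ 1 := mul_le_one₀ (w s(v, b)).2.2 (w s(v, b')).2.1 (w s(v, b')).2.2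
  have hτ0 : 0 ≤ ((w s(u, c) : ℝ) * (w s(u, a') : ℝ)) := mul_nonneg hp0 hq0
  have hτ1 : ((w s(u, c) : ℝ) * (w s(u, a') : ℝ)) ≤ 1 := mul_le_one₀ hp1 hq0 hq1
  -- translations
  obtain ⟨-, -, -, e0L, eG0b, eG0c, -, -⟩ :=
    iffs_base_u A ω u v c a' b b' b j hj hu hv huv hc ha' hb hb' hb hca' hcb ha'b hcb.symm ha'b.symm hisoU hisoV
  obtain ⟨-, -, -, -, eG0b', -, -, -⟩ :=
    iffs_base_u A ω u v c a' b b' b' j hj hu hv huv hc ha' hb hb' hb' hca' hcb ha'b hcb'.symm ha'b'.symm hisoU hisoV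
  obtain ⟨-, -, -, -, -, eG0a, -, -⟩ :=
    iffs_base_u A ω u v a' c b b' b j hj hu hv huv ha' hc hb hb' hb hca'.symm ha'b hcb ha'b.symm hcb.symm hisoU hisoV
  obtain ⟨eVc, eVa, eVb, eVr, eVl⟩ :=
    iffs_v A ω u v a' c b b' c j hj hu hv huv ha' hc hb hb' hc hbb' ha'b ha'b' hcb hcb' hisoU hisoV
  obtain ⟨-, -, eVb', -, -⟩ :=
    iffs_v A ω u v a' c b' b c j hj hu hv huv ha' hc hb' hb hc hbb'.symm ha'b' ha'b hcb' hcb hisoU hisoV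
  obtain ⟨eP0r, eP0l, ePVr, ePVl⟩ :=
    iffs_cport_pendant A ω u v c a' b b' j hj hu hv huv hc ha' hb hb' hcb hcb' ha'b ha'b' hbb' hisoU hisoV
  obtain ⟨eP0c, eP0L⟩ := iffs_cport_pendant' A ω u c a' j hu hc ha' hisoU
  obtain ⟨eGVc, eGVb⟩ := iffs_w_ab A ω u v c a' b b' j hj hu hv huv hc ha' hb hb' hca' hbb' hcb hcb' ha'b ha'b' hisoU hisoV
  obtain ⟨-, eGVb'⟩ := iffs_w_ab A ω u v c a' b' b j hj hu hv huv hc ha' hb' hb hca' hbb'.symm hcb' hcb ha'b' ha'b hisoU hisoV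
  obtain ⟨eGVa, -⟩ := iffs_w_ab A ω u v a' c b b' j hj hu hv huv ha' hc hb hb' hca'.symm hbb' ha'b ha'b' hcb hcb' hisoU hisoV
  -- normalise the swapped instances
  have hVcomm : (fun ω : BondConfig (Fin n) => insert s(v, b') (insert s(v, b) ω)) =
      (fun ω : BondConfig (Fin n) => insert s(v, b) (insert s(v, b') ω)) := funext (fun ω => Set.insert_comm _ _ _)
  have hGcomm : (fun ω : BondConfig (Fin n) => insert s(u, a') (insert s(u, c) ω)) =
      (fun ω : BondConfig (Fin n) => insert s(u, c) (insert s(u, a') ω)) := funext (fun ω => Set.insert_comm _ _ _)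
  have hGVcomm1 : (fun ω : BondConfig (Fin n) => insert s(u, c) (insert s(u, a') (insert s(v, b') (insert s(v, b) ω)))) =
      (fun ω : BondConfig (Fin n) => insert s(u, c) (insert s(u, a') (insert s(v, b) (insert s(v, b') ω)))) :=
    funext (fun ω => congrArg (insert s(u, c)) (congrArg (insert s(u, a')) (Set.insert_comm (s(v, b')) (s(v, b)) ω)))
  have hGVcomm2 : (fun ω : BondConfig (Fin n) => insert s(u, a') (insert s(u, c) (insert s(v, b) (insert s(v, b') ω)))) =
      (fun ω : BondConfig (Fin n) => insert s(u, c) (insert s(u, a') (insert s(v, b) (insert s(v, b') ω)))) :=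
    funext (fun ω => Set.insert_comm _ _ _)
  rw [hVcomm, Finset.union_comm] at eVb'
  rw [hGcomm, Finset.union_comm] at eG0a
  rw [hGVcomm1, Finset.union_comm] at eGVb'
  rw [hGVcomm2, Finset.union_comm] at eGVa
  -- level-2 structure
  have hG : (((A.filter fun z => ω ∈ openConn c z) ∪ (A.filter fun z => ω ∈ openConn a' z)).card ≤ j) → ((A.filter fun z => ω ∈ openConn c z).card ≤ j) ∧ ¬ ((openGraph ω).Reachable c b) ∧ ¬ ((openGraph ω).Reachable c b') := fun h =>
    ⟨le_trans (Finset.card_le_card Finset.subset_union_left) h,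
      fun hr => (not_reachable_of_small_pair A ω j hj hc ha' hb hca' hcb.symm ha'b.symm h).1 hr.symm,
      fun hr => (not_reachable_of_small_pair A ω j hj hc ha' hb' hca' hcb'.symm ha'b'.symm h).1 hr.symm⟩
  have hE1 : ((A.filter fun z => ω ∈ openConn c z).card ≤ j) → ((openGraph ω).Reachable c a') → ((A.filter fun z => ω ∈ openConn a' z).card ≤ j) := fun hS hE => by
    rw [filter_eq_of_reachable A ω hE] at hS; exact hS
  have hE2 : ((A.filter fun z => ω ∈ openConn c z).card ≤ j) → ((openGraph ω).Reachable c a') → (((openGraph ω).Reachable a' b ∨ (openGraph ω).Reachable a' b') ↔ (((openGraph ω).Reachable c b) ∨ ((openGraph ω).Reachable c b'))) := fun _ hE =>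
    ⟨fun h => h.elim (fun h1 => Or.inl (hE.trans h1)) (fun h1 => Or.inr (hE.trans h1)),
      fun h => h.elim (fun h1 => Or.inl (hE.symm.trans h1)) (fun h1 => Or.inr (hE.symm.trans h1))⟩
  have hE3 : ((openGraph ω).Reachable c a') → (((A.filter fun z => ω ∈ openConn c z).card ≤ j) ↔ ((A.filter fun z => ω ∈ openConn a' z).card ≤ j)) := fun hE => by rw [filter_eq_of_reachable A ω hE]
  have hB : (((A.filter fun z => ω ∈ openConn b z) ∪ (A.filter fun z => ω ∈ openConn b' z)).card ≤ j) → ((A.filter fun z => ω ∈ openConn b z).card ≤ j) ∧ ((A.filter fun z => ω ∈ openConn b' z).card ≤ j) ∧ ¬ ((openGraph ω).Reachable c b) ∧ ¬ ((openGraph ω).Reachable c b') ∧ ¬ ((openGraph ω).Reachable b c ∨ (openGraph ω).Reachable b a') ∧ ¬ ((openGraph ω).Reachable b' c ∨ (openGraph ω).Reachable b' a') := fun h => by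
    have h1 := not_reachable_of_small_pair A ω j hj hb hb' hc hbb' hcb hcb' h
    have h2 := not_reachable_of_small_pair A ω j hj hb hb' ha' hbb' ha'b ha'b' h
    exact ⟨le_trans (Finset.card_le_card Finset.subset_union_left) h,
      le_trans (Finset.card_le_card Finset.subset_union_right) h, h1.1, h1.2,
      fun hr => hr.elim (fun h3 => h1.1 h3.symm) (fun h3 => h2.1 h3.symm),
      fun hr => hr.elim (fun h3 => h1.2 h3.symm) (fun h3 => h2.2 h3.symm)⟩
  have hKbs : ((A.filter fun z => ω ∈ openConn c z).card ≤ j) → ((openGraph ω).Reachable c b) → ((A.filter fun z => ω ∈ openConn b z).card ≤ j) ∧ ((openGraph ω).Reachable b c ∨ (openGraph ω).Reachable b a') ∧ ¬ ((openGraph ω).Reachable c b') ∧ ¬ (((A.filter fun z => ω ∈ openConn b z) ∪ (A.filter fun z => ω ∈ openConn b' z)).card ≤ j) ∧ ¬ (((A.filter fun z => ω ∈ openConn c z) ∪ (A.filter fun z => ω ∈ openConn a' z)).card ≤ j) := fun hS hk => by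
    refine ⟨by rw [filter_eq_of_reachable A ω hk] at hS; exact hS, Or.inl hk.symm, fun hk' => ?_, fun h2 => (hB h2).2.2.1 hk,
      fun h2 => (hG h2).2.1 hk⟩
    have m1 : c ∈ (A.filter fun z => ω ∈ openConn c z) :=
      Finset.mem_filter.2 ⟨hc, (SimpleGraph.Reachable.refl _ : (openGraph ω).Reachable c c)⟩
    have m2 : b ∈ (A.filter fun z => ω ∈ openConn c z) := Finset.mem_filter.2 ⟨hb, hk⟩
    have m3 : b' ∈ (A.filter fun z => ω ∈ openConn c z) := Finset.mem_filter.2 ⟨hb', hk'⟩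
    have h3 := three_le_card_of_mem m1 m2 m3 hcb hcb' hbb'
    omega
  have hKbs' : ((A.filter fun z => ω ∈ openConn c z).card ≤ j) → ((openGraph ω).Reachable c b') → ((A.filter fun z => ω ∈ openConn b' z).card ≤ j) ∧ ((openGraph ω).Reachable b' c ∨ (openGraph ω).Reachable b' a') ∧ ¬ ((openGraph ω).Reachable c b) ∧ ¬ (((A.filter fun z => ω ∈ openConn b z) ∪ (A.filter fun z => ω ∈ openConn b' z)).card ≤ j) ∧ ¬ (((A.filter fun z => ω ∈ openConn c z) ∪ (A.filter fun z => ω ∈ openConn a' z)).card ≤ j) := fun hS hk' => by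
    refine ⟨by rw [filter_eq_of_reachable A ω hk'] at hS; exact hS, Or.inl hk'.symm, fun hk => ?_, fun h2 => (hB h2).2.2.2.1 hk',
      fun h2 => (hG h2).2.2 hk'⟩
    have m1 : c ∈ (A.filter fun z => ω ∈ openConn c z) :=
      Finset.mem_filter.2 ⟨hc, (SimpleGraph.Reachable.refl _ : (openGraph ω).Reachable c c)⟩
    have m2 : b ∈ (A.filter fun z => ω ∈ openConn c z) := Finset.mem_filter.2 ⟨hb, hk⟩
    have m3 : b' ∈ (A.filter fun z => ω ∈ openConn c z) := Finset.mem_filter.2 ⟨hb', hk'⟩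
    have h3 := three_le_card_of_mem m1 m2 m3 hcb hcb' hbb'
    omega
  have key := cport_pointwise_abstract ω ((w s(v, b) : ℝ) * w s(v, b')) (w s(u, a') : ℝ) ((w s(u, c) : ℝ) * (w s(u, a') : ℝ)) hs0 hs1 hq0 hq1 hτ0 hτ1
    ((A.filter fun z => ω ∈ openConn c z).card ≤ j) ((A.filter fun z => ω ∈ openConn a' z).card ≤ j) ((A.filter fun z => ω ∈ openConn b z).card ≤ j) ((A.filter fun z => ω ∈ openConn b' z).card ≤ j) (((A.filter fun z => ω ∈ openConn b z) ∪ (A.filter fun z => ω ∈ openConn b' z)).card ≤ j) (((A.filter fun z => ω ∈ openConn c z) ∪ (A.filter fun z => ω ∈ openConn a' z)).card ≤ j) ((openGraph ω).Reachable c b) ((openGraph ω).Reachable c b') ((openGraph ω).Reachable a' b ∨ (openGraph ω).Reachable a' b') ((openGraph ω).Reachable c a') ((openGraph ω).Reachable b c ∨ (openGraph ω).Reachable b a') ((openGraph ω).Reachable b' c ∨ (openGraph ω).Reachable b' a')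
    hG hE1 hE2 hE3 hB hKbs hKbs'
    ({ω : BondConfig (Fin n) | (A.filter fun z => ω ∈ openConn c z).card ≤ j}) ({ω : BondConfig (Fin n) | (A.filter fun z => ω ∈ openConn a' z).card ≤ j}) ({ω : BondConfig (Fin n) | (A.filter fun z => ω ∈ openConn b z).card ≤ j}) ({ω : BondConfig (Fin n) | (A.filter fun z => ω ∈ openConn b' z).card ≤ j}) (((fun ω : BondConfig (Fin n) => insert s(v, b) (insert s(v, b') ω)) ⁻¹' {ω : BondConfig (Fin n) | ω ∉ openConn c u ∧ ω ∉ openConn c v ∧ (A.filter fun z => ω ∈ openConn c z).card ≤ j})) (((fun ω : BondConfig (Fin n) => insert s(v, b) (insert s(v, b') ω)) ⁻¹' {ω : BondConfig (Fin n) | ω ∉ openConn c u ∧ ω ∉ openConn c v ∧ 1 ≤ (A.filter fun z => ω ∈ openConn u z ∨ ω ∈ openConn v z).card ∧ (A.filter fun z => ω ∈ openConn u z ∨ ω ∈ openConn v z).card ≤ j})) (((fun ω : BondConfig (Fin n) => insert s(v, b) (insert s(v, b') ω)) ⁻¹' {ω : BondConfig (Fin n) | (A.filter fun z => ω ∈ openConn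 c z).card ≤ j})) (((fun ω : BondConfig (Fin n) => insert s(v, b) (insert s(v, b') ω)) ⁻¹' {ω : BondConfig (Fin n) | (A.filter fun z => ω ∈ openConn a' z).card ≤ j})) (((fun ω : BondConfig (Fin n) => insert s(v, b) (insert s(v, b') ω)) ⁻¹' {ω : BondConfig (Fin n) | (A.filter fun z => ω ∈ openConn b z).card ≤ j})) (((fun ω : BondConfig (Fin n) => insert s(v, b) (insert s(v, b') ω)) ⁻¹' {ω : BondConfig (Fin n) | (A.filter fun z => ω ∈ openConn b' z).card ≤ j})) (((fun ω : BondConfig (Fin n) => insert s(u, a') ω) ⁻¹' {ω : BondConfig (Fin n) | ω ∉ openConn c u ∧ ω ∉ openConn c v ∧ (A.filter fun z => ω ∈ openConn c z).card ≤ j})) (((fun ω : BondConfig (Fin n) => insert s(u, a') ω) ⁻¹' {ω : BondConfig (Fin n) | ω ∉ openConn c u ∧ ω ∉ openConn c v ∧ 1 ≤ (A.filter fun z => ω ∈ openConn u z ∨ ω ∈ openConn v z).card ∧ (A.filter fun z => ω ∈ openConn u z ∨ ω ∈ openConn v z).card ≤ j})) (((fun ω : BondConfig (Fin n) => insert s(u,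 a') (insert s(v, b) (insert s(v, b') ω))) ⁻¹' {ω : BondConfig (Fin n) | ω ∉ openConn c u ∧ ω ∉ openConn c v ∧ (A.filter fun z => ω ∈ openConn c z).card ≤ j})) (((fun ω : BondConfig (Fin n) => insert s(u, a') (insert s(v, b) (insert s(v, b') ω))) ⁻¹' {ω : BondConfig (Fin n) | ω ∉ openConn c u ∧ ω ∉ openConn c v ∧ 1 ≤ (A.filter fun z => ω ∈ openConn u z ∨ ω ∈ openConn v z).card ∧ (A.filter fun z => ω ∈ openConn u z ∨ ω ∈ openConn v z).card ≤ j})) (((fun ω : BondConfig (Fin n) => insert s(u, c) (insert s(u, a') ω)) ⁻¹' {ω : BondConfig (Fin n) | (A.filter fun z => ω ∈ openConn c z).card ≤ j})) (((fun ω : BondConfig (Fin n) => insert s(u, c) (insert s(u, a') ω)) ⁻¹' {ω : BondConfig (Fin n) | (A.filter fun z => ω ∈ openConn b z).card ≤ j})) (((fun ω : BondConfig (Fin n) => insert s(u, c) (insert s(u, a') ω)) ⁻¹' {ω : BondConfig (Fin n) | (A.filter fun z => ω ∈ openConn b' z).card ≤ j})) (((fun ω : BondConfig (Fin n) => insert s(u,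 c) (insert s(u, a') (insert s(v, b) (insert s(v, b') ω)))) ⁻¹' {ω : BondConfig (Fin n) | (A.filter fun z => ω ∈ openConn c z).card ≤ j})) (((fun ω : BondConfig (Fin n) => insert s(u, c) (insert s(u, a') (insert s(v, b) (insert s(v, b') ω)))) ⁻¹' {ω : BondConfig (Fin n) | (A.filter fun z => ω ∈ openConn b z).card ≤ j})) (((fun ω : BondConfig (Fin n) => insert s(u, c) (insert s(u, a') (insert s(v, b) (insert s(v, b') ω)))) ⁻¹' {ω : BondConfig (Fin n) | (A.filter fun z => ω ∈ openConn b' z).card ≤ j}))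
    Iff.rfl Iff.rfl Iff.rfl Iff.rfl (eVr.trans (by rw [not_or, and_assoc])) (eVl.trans (by rw [not_or, and_assoc]))
    (eVc.trans (by rw [not_or, and_assoc])) eVa eVb eVb' eP0r eP0l ePVr ePVl eG0c eG0b eG0b' eGVc eGVb eGVb'
  -- bridging: the goal-form events versus the abstract ones
  have bL : Set.indicator {ω : BondConfig (Fin n) | 1 ≤ (A.filter fun z => ω ∈ openConn u z).card ∧ (A.filter fun z => ω ∈ openConn u z).card ≤ j} (1 : BondConfig (Fin n) → ℝ) ω = 0 := Set.indicator_of_notMem (fun h => e0L.1 h) _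
  have bG : Set.indicator ((fun ω : BondConfig (Fin n) => insert s(u, c) (insert s(u, a') ω)) ⁻¹' {ω : BondConfig (Fin n) | (A.filter fun z => ω ∈ openConn a' z).card ≤ j}) (1 : BondConfig (Fin n) → ℝ) ω = Set.indicator ((fun ω : BondConfig (Fin n) => insert s(u, c) (insert s(u, a') ω)) ⁻¹' {ω : BondConfig (Fin n) | (A.filter fun z => ω ∈ openConn c z).card ≤ j}) (1 : BondConfig (Fin n) → ℝ) ω := by
    by_cases hg : (((A.filter fun z => ω ∈ openConn c z) ∪ (A.filter fun z => ω ∈ openConn a' z)).card ≤ j)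
    · rw [Set.indicator_of_mem (eG0a.2 hg), Set.indicator_of_mem (eG0c.2 hg)]
    · rw [Set.indicator_of_notMem (fun h => hg (eG0a.1 h)), Set.indicator_of_notMem (fun h => hg (eG0c.1 h))]
  have bGV : Set.indicator ((fun ω : BondConfig (Fin n) => insert s(u, c) (insert s(u, a') (insert s(v, b) (insert s(v, b') ω)))) ⁻¹' {ω : BondConfig (Fin n) | (A.filter fun z => ω ∈ openConn a' z).card ≤ j}) (1 : BondConfig (Fin n) → ℝ) ω = Set.indicator ((fun ω : BondConfig (Fin n) => insert s(u, c) (insert s(u, a') (insert s(v, b) (insert s(v, b') ω)))) ⁻¹' {ω : BondConfig (Fin n) | (A.filter fun z => ω ∈ openConn c z).card ≤ j}) (1 : BondConfig (Fin n) → ℝ) ω := by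
    by_cases hg : (((A.filter fun z => ω ∈ openConn c z) ∪ (A.filter fun z => ω ∈ openConn a' z)).card ≤ j)
    · rw [Set.indicator_of_mem (eGVa.2 hg), Set.indicator_of_mem (eGVc.2 hg)]
    · rw [Set.indicator_of_notMem (fun h => hg (eGVa.1 h)), Set.indicator_of_notMem (fun h => hg (eGVc.1 h))]
  have h1τ : 0 ≤ 1 - ((w s(u, c) : ℝ) * (w s(u, a') : ℝ)) := sub_nonneg.2 hτ1
  simp only [List.map_cons, List.map_nil, List.sum_cons, List.sum_nil]
  rw [bL, bG, bGV]
  by_cases hE : ((openGraph ω).Reachable c a')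
  · have r1 : Set.indicator ((fun ω : BondConfig (Fin n) => insert s(u, a') ω) ⁻¹' {ω : BondConfig (Fin n) | ω ∉ openConn c u ∧ ω ∉ openConn c v ∧ (A.filter fun z => ω ∈ openConn c z).card ≤ j}) (1 : BondConfig (Fin n) → ℝ) ω = 0 := Set.indicator_of_notMem (fun h => (eP0r.1 h).1 hE) _
    have r2 : Set.indicator ((fun ω : BondConfig (Fin n) => insert s(u, a') ω) ⁻¹' {ω : BondConfig (Fin n) | ω ∉ openConn c u ∧ ω ∉ openConn c v ∧ 1 ≤ (A.filter fun z => ω ∈ openConn u z ∨ ω ∈ openConn v z).card ∧ (A.filter fun z => ω ∈ openConn u z ∨ ω ∈ openConn v z).card ≤ j}) (1 : BondConfig (Fin n) → ℝ) ω = 0 := Set.indicator_of_notMem (fun h => (eP0l.1 h).1 hE) _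
    have r3 : Set.indicator ((fun ω : BondConfig (Fin n) => insert s(u, a') ω) ⁻¹' {ω : BondConfig (Fin n) | 1 ≤ (A.filter fun z => ω ∈ openConn u z).card ∧ (A.filter fun z => ω ∈ openConn u z).card ≤ j}) (1 : BondConfig (Fin n) → ℝ) ω = Set.indicator ((fun ω : BondConfig (Fin n) => insert s(u, a') ω) ⁻¹' {ω : BondConfig (Fin n) | (A.filter fun z => ω ∈ openConn c z).card ≤ j}) (1 : BondConfig (Fin n) → ℝ) ω := by
      by_cases hS : ((A.filter fun z => ω ∈ openConn c z).card ≤ j)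
      · rw [Set.indicator_of_mem (eP0c.2 hS), Set.indicator_of_mem (eP0L.2 ((hE3 hE).1 hS))]
      · rw [Set.indicator_of_notMem (fun h => hS (eP0c.1 h)),
          Set.indicator_of_notMem (fun h => hS ((hE3 hE).2 (eP0L.1 h)))]
    rw [r1, r2] at key
    rw [r3]
    have k2 := mul_nonneg h1τ key
    linarith
  · have r1 : Set.indicator ((fun ω : BondConfig (Fin n) => insert s(u, a') ω) ⁻¹' {ω : BondConfig (Fin n) | (A.filter fun z => ω ∈ openConn c z).card ≤ j}) (1 : BondConfig (Fin n) → ℝ) ω = Set.indicator ((fun ω : BondConfig (Fin n) => insert s(u, a') ω) ⁻¹' {ω : BondConfig (Fin n) | ω ∉ openConn c u ∧ ω ∉ openConn c v ∧ (A.filter fun z => ω ∈ openConn c z).card ≤ j}) (1 : BondConfig (Fin n) → ℝ) ω := by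
      by_cases hS : ((A.filter fun z => ω ∈ openConn c z).card ≤ j)
      · rw [Set.indicator_of_mem (eP0c.2 hS), Set.indicator_of_mem (eP0r.2 ⟨hE, hS⟩)]
      · rw [Set.indicator_of_notMem (fun h => hS (eP0c.1 h)), Set.indicator_of_notMem (fun h => hS (eP0r.1 h).2)]
    have r2 : Set.indicator ((fun ω : BondConfig (Fin n) => insert s(u, a') ω) ⁻¹' {ω : BondConfig (Fin n) | 1 ≤ (A.filter fun z => ω ∈ openConn u z).card ∧ (A.filter fun z => ω ∈ openConn u z).card ≤ j}) (1 : BondConfig (Fin n) → ℝ) ω = Set.indicator ((fun ω : BondConfig (Fin n) => insert s(u, a') ω) ⁻¹' {ω : BondConfig (Fin n) | ω ∉ openConn c u ∧ ω ∉ openConn c v ∧ 1 ≤ (A.filter fun z => ω ∈ openConn u z ∨ ω ∈ openConn v z).card ∧ (A.filter fun z => ω ∈ openConn u z ∨ ω ∈ openConn v z).card ≤ j}) (1 : BondConfig (Fin n) → ℝ) ω := by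
      by_cases hA : ((A.filter fun z => ω ∈ openConn a' z).card ≤ j)
      · rw [Set.indicator_of_mem (eP0L.2 hA), Set.indicator_of_mem (eP0l.2 ⟨hE, hA⟩)]
      · rw [Set.indicator_of_notMem (fun h => hA (eP0L.1 h)), Set.indicator_of_notMem (fun h => hA (eP0l.1 h).2)]
    rw [r1, r2]
    have k2 := mul_nonneg h1τ key
    linarith

/-- The champion-at-a-port certificate holds almost surely under the base measure (list form). [this file] -/
theorem cport_certificate_ae (w : Sym2 (Fin n) → unitInterval) (A : Finset (Fin n))
    (u v c a' b b' : Fin n) (j : ℕ) (hj : j ≤ 2) (hu : u ∉ A) (hv : v ∉ A) (huv : u ≠ v)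
    (hc : c ∈ A) (ha' : a' ∈ A) (hb : b ∈ A) (hb' : b' ∈ A)
    (hca' : c ≠ a') (hcb : c ≠ b) (hcb' : c ≠ b') (ha'b : a' ≠ b) (ha'b' : a' ≠ b') (hbb' : b ≠ b')
    (hutwo : ∀ y : Fin n, y ≠ u → y ≠ c → y ≠ a' → w s(u, y) = 0)
    (hvtwo : ∀ y : Fin n, y ≠ v → y ≠ b → y ≠ b' → w s(v, y) = 0) :
    ∀ᵐ ω ∂(prodBernoulli (Function.update (Function.update (Function.update (Function.update w s(v, b) 0) s(v, b') 0) s(u, c) 0) s(u, a') 0)),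
      0 ≤ (([(((1 - ((w s(u, c) : ℝ) * (w s(u, a') : ℝ))) * ((1 - (w s(u, a') : ℝ)) * (1 - ((w s(v, b) : ℝ) * w s(v, b'))))), {ω : BondConfig (Fin n) | (A.filter fun z => ω ∈ openConn c z).card ≤ j}),
      ((-((1 - ((w s(u, c) : ℝ) * (w s(u, a') : ℝ))) * ((1 - (w s(u, a') : ℝ)) * (1 - ((w s(v, b) : ℝ) * w s(v, b')))))), {ω : BondConfig (Fin n) | 1 ≤ (A.filter fun z => ω ∈ openConn u z).card ∧ (A.filter fun z => ω ∈ openConn u z).card ≤ j}),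
      (((1 - ((w s(u, c) : ℝ) * (w s(u, a') : ℝ))) * ((1 - (w s(u, a') : ℝ)) * ((w s(v, b) : ℝ) * w s(v, b')))), ((fun ω : BondConfig (Fin n) => insert s(v, b) (insert s(v, b') ω)) ⁻¹' {ω : BondConfig (Fin n) | ω ∉ openConn c u ∧ ω ∉ openConn c v ∧ (A.filter fun z => ω ∈ openConn c z).card ≤ j})),
      ((-((1 - ((w s(u, c) : ℝ) * (w s(u, a') : ℝ))) * ((1 - (w s(u, a') : ℝ)) * ((w s(v, b) : ℝ) * w s(v, b'))))), ((fun ω : BondConfig (Fin n) => insert s(v, b) (insert s(v, b') ω)) ⁻¹' {ω : BondConfig (Fin n) | ω ∉ openConn c u ∧ ω ∉ openConn c v ∧ 1 ≤ (A.filter fun z => ω ∈ openConn u z ∨ ω ∈ openConn v z).card ∧ (A.filter fun z => ω ∈ openConn u z ∨ ω ∈ openConn v z).card ≤ j})),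
      (((1 - ((w s(u, c) : ℝ) * (w s(u, a') : ℝ))) * ((w s(u, a') : ℝ) * (1 - ((w s(v, b) : ℝ) * w s(v, b'))))), ((fun ω : BondConfig (Fin n) => insert s(u, a') ω) ⁻¹' {ω : BondConfig (Fin n) | (A.filter fun z => ω ∈ openConn c z).card ≤ j})),
      ((-((1 - ((w s(u, c) : ℝ) * (w s(u, a') : ℝ))) * ((w s(u, a') : ℝ) * (1 - ((w s(v, b) : ℝ) * w s(v, b')))))), ((fun ω : BondConfig (Fin n) => insert s(u, a') ω) ⁻¹' {ω : BondConfig (Fin n) | 1 ≤ (A.filter fun z => ω ∈ openConn u z).card ∧ (A.filter fun z => ω ∈ openConn u z).card ≤ j})),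
      (((1 - ((w s(u, c) : ℝ) * (w s(u, a') : ℝ))) * ((w s(u, a') : ℝ) * ((w s(v, b) : ℝ) * w s(v, b')))), ((fun ω : BondConfig (Fin n) => insert s(u, a') (insert s(v, b) (insert s(v, b') ω))) ⁻¹' {ω : BondConfig (Fin n) | ω ∉ openConn c u ∧ ω ∉ openConn c v ∧ (A.filter fun z => ω ∈ openConn c z).card ≤ j})),
      ((-((1 - ((w s(u, c) : ℝ) * (w s(u, a') : ℝ))) * ((w s(u, a') : ℝ) * ((w s(v, b) : ℝ) * w s(v, b'))))), ((fun ω : BondConfig (Fin n) => insert s(u, a') (insert s(v, b) (insert s(v, b') ω))) ⁻¹' {ω : BondConfig (Fin n) | ω ∉ openConn c u ∧ ω ∉ openConn c v ∧ 1 ≤ (A.filter fun z => ω ∈ openConn u z ∨ ω ∈ openConn v z).card ∧ (A.filter fun z => ω ∈ openConn u z ∨ ω ∈ openConn v z).card ≤ j})),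
      ((-((w s(u, a') : ℝ) * ((1 - ((w s(u, c) : ℝ) * (w s(u, a') : ℝ))) * (1 - ((w s(v, b) : ℝ) * w s(v, b')))))), {ω : BondConfig (Fin n) | (A.filter fun z => ω ∈ openConn c z).card ≤ j}),
      (((w s(u, a') : ℝ) * ((1 - ((w s(u, c) : ℝ) * (w s(u, a') : ℝ))) * (1 - ((w s(v, b) : ℝ) * w s(v, b'))))), {ω : BondConfig (Fin n) | (A.filter fun z => ω ∈ openConn a' z).card ≤ j}),
      ((-((w s(u, a') : ℝ) * ((1 - ((w s(u, c) : ℝ) * (w s(u, a') : ℝ))) * ((w s(v, b) : ℝ) * w s(v, b'))))), ((fun ω : BondConfig (Fin n) => insert s(v, b) (insert s(v, b') ω)) ⁻¹' {ω : BondConfig (Fin n) | (A.filter fun z => ω ∈ openConn c z).card ≤ j})),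
      (((w s(u, a') : ℝ) * ((1 - ((w s(u, c) : ℝ) * (w s(u, a') : ℝ))) * ((w s(v, b) : ℝ) * w s(v, b')))), ((fun ω : BondConfig (Fin n) => insert s(v, b) (insert s(v, b') ω)) ⁻¹' {ω : BondConfig (Fin n) | (A.filter fun z => ω ∈ openConn a' z).card ≤ j})),
      ((-((w s(u, a') : ℝ) * (((w s(u, c) : ℝ) * (w s(u, a') : ℝ)) * (1 - ((w s(v, b) : ℝ) * w s(v, b')))))), ((fun ω : BondConfig (Fin n) => insert s(u, c) (insert s(u, a') ω)) ⁻¹' {ω : BondConfig (Fin n) | (A.filter fun z => ω ∈ openConn c z).card ≤ j})),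
      (((w s(u, a') : ℝ) * (((w s(u, c) : ℝ) * (w s(u, a') : ℝ)) * (1 - ((w s(v, b) : ℝ) * w s(v, b'))))), ((fun ω : BondConfig (Fin n) => insert s(u, c) (insert s(u, a') ω)) ⁻¹' {ω : BondConfig (Fin n) | (A.filter fun z => ω ∈ openConn a' z).card ≤ j})),
      ((-((w s(u, a') : ℝ) * (((w s(u, c) : ℝ) * (w s(u, a') : ℝ)) * ((w s(v, b) : ℝ) * w s(v, b'))))), ((fun ω : BondConfig (Fin n) => insert s(u, c) (insert s(u, a') (insert s(v, b) (insert s(v, b') ω)))) ⁻¹' {ω : BondConfig (Fin n) | (A.filter fun z => ω ∈ openConn c z).card ≤ j})),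
      (((w s(u, a') : ℝ) * (((w s(u, c) : ℝ) * (w s(u, a') : ℝ)) * ((w s(v, b) : ℝ) * w s(v, b')))), ((fun ω : BondConfig (Fin n) => insert s(u, c) (insert s(u, a') (insert s(v, b) (insert s(v, b') ω)))) ⁻¹' {ω : BondConfig (Fin n) | (A.filter fun z => ω ∈ openConn a' z).card ≤ j})),
      ((-((1 - ((w s(u, c) : ℝ) * (w s(u, a') : ℝ))) * (((w s(v, b) : ℝ) * w s(v, b')) * (1 - (w s(u, a') : ℝ)) / 2) * ((1 - ((w s(u, c) : ℝ) * (w s(u, a') : ℝ))) * (1 - ((w s(v, b) : ℝ) * w s(v, b')))))), {ω : BondConfig (Fin n) | (A.filter fun z => ω ∈ openConn c z).card ≤ j}),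
      (((1 - ((w s(u, c) : ℝ) * (w s(u, a') : ℝ))) * (((w s(v, b) : ℝ) * w s(v, b')) * (1 - (w s(u, a') : ℝ)) / 2) * ((1 - ((w s(u, c) : ℝ) * (w s(u, a') : ℝ))) * (1 - ((w s(v, b) : ℝ) * w s(v, b'))))), {ω : BondConfig (Fin n) | (A.filter fun z => ω ∈ openConn b z).card ≤ j}),
      ((-((1 - ((w s(u, c) : ℝ) * (w s(u, a') : ℝ))) * (((w s(v, b) : ℝ) * w s(v, b')) * (1 - (w s(u, a') : ℝ)) / 2) * ((1 - ((w s(u, c) : ℝ) * (w s(u, a') : ℝ))) * ((w s(v, b) : ℝ) * w s(v, b'))))), ((fun ω : BondConfig (Fin n) => insert s(v, b) (insert s(v, b') ω)) ⁻¹' {ω : BondConfig (Fin n) | (A.filter fun z => ω ∈ openConn c z).card ≤ j})),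
      (((1 - ((w s(u, c) : ℝ) * (w s(u, a') : ℝ))) * (((w s(v, b) : ℝ) * w s(v, b')) * (1 - (w s(u, a') : ℝ)) / 2) * ((1 - ((w s(u, c) : ℝ) * (w s(u, a') : ℝ))) * ((w s(v, b) : ℝ) * w s(v, b')))), ((fun ω : BondConfig (Fin n) => insert s(v, b) (insert s(v, b') ω)) ⁻¹' {ω : BondConfig (Fin n) | (A.filter fun z => ω ∈ openConn b z).card ≤ j})),
      ((-((1 - ((w s(u, c) : ℝ) * (w s(u, a') : ℝ))) * (((w s(v, b) : ℝ) * w s(v, b')) * (1 - (w s(u, a') : ℝ)) / 2) * (((w s(u, c) : ℝ) * (w s(u, a') : ℝ)) * (1 - ((w s(v, b) : ℝ) * w s(v, b')))))), ((fun ω : BondConfig (Fin n) => insert s(u, c) (insert s(u, a') ω)) ⁻¹' {ω : BondConfig (Fin n) | (A.filter fun z => ω ∈ openConn c z).card ≤ j})),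
      (((1 - ((w s(u, c) : ℝ) * (w s(u, a') : ℝ))) * (((w s(v, b) : ℝ) * w s(v, b')) * (1 - (w s(u, a') : ℝ)) / 2) * (((w s(u, c) : ℝ) * (w s(u, a') : ℝ)) * (1 - ((w s(v, b) : ℝ) * w s(v, b'))))), ((fun ω : BondConfig (Fin n) => insert s(u, c) (insert s(u, a') ω)) ⁻¹' {ω : BondConfig (Fin n) | (A.filter fun z => ω ∈ openConn b z).card ≤ j})),
      ((-((1 - ((w s(u, c) : ℝ) * (w s(u, a') : ℝ))) * (((w s(v, b) : ℝ) * w s(v, b')) * (1 - (w s(u, a') : ℝ)) / 2) * (((w s(u, c) : ℝ) * (w s(u, a') : ℝ)) * ((w s(v, b) : ℝ) * w s(v, b'))))), ((fun ω : BondConfig (Fin n) => insert s(u, c) (insert s(u, a') (insert s(v, b) (insert s(v, b') ω)))) ⁻¹' {ω : BondConfig (Fin n) | (A.filter fun z => ω ∈ openConn c z).card ≤ j})),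
      (((1 - ((w s(u, c) : ℝ) * (w s(u, a') : ℝ))) * (((w s(v, b) : ℝ) * w s(v, b')) * (1 - (w s(u, a') : ℝ)) / 2) * (((w s(u, c) : ℝ) * (w s(u, a') : ℝ)) * ((w s(v, b) : ℝ) * w s(v, b')))), ((fun ω : BondConfig (Fin n) => insert s(u, c) (insert s(u, a') (insert s(v, b) (insert s(v, b') ω)))) ⁻¹' {ω : BondConfig (Fin n) | (A.filter fun z => ω ∈ openConn b z).card ≤ j})),
      ((-((1 - ((w s(u, c) : ℝ) * (w s(u, a') : ℝ))) * (((w s(v, b) : ℝ) * w s(v, b')) * (1 - (w s(u, a') : ℝ)) / 2) * ((1 - ((w s(u, c) : ℝ) * (w s(u, a') : ℝ))) * (1 - ((w s(v, b) : ℝ) * w s(v, b')))))), {ω : BondConfig (Fin n) | (A.filter fun z => ω ∈ openConn c z).card ≤ j}),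
      (((1 - ((w s(u, c) : ℝ) * (w s(u, a') : ℝ))) * (((w s(v, b) : ℝ) * w s(v, b')) * (1 - (w s(u, a') : ℝ)) / 2) * ((1 - ((w s(u, c) : ℝ) * (w s(u, a') : ℝ))) * (1 - ((w s(v, b) : ℝ) * w s(v, b'))))), {ω : BondConfig (Fin n) | (A.filter fun z => ω ∈ openConn b' z).card ≤ j}),
      ((-((1 - ((w s(u, c) : ℝ) * (w s(u, a') : ℝ))) * (((w s(v, b) : ℝ) * w s(v, b')) * (1 - (w s(u, a') : ℝ)) / 2) * ((1 - ((w s(u, c) : ℝ) * (w s(u, a') : ℝ))) * ((w s(v, b) : ℝ) * w s(v, b'))))), ((fun ω : BondConfig (Fin n) => insert s(v, b) (insert s(v, b') ω)) ⁻¹' {ω : BondConfig (Fin n) | (A.filter fun z => ω ∈ openConn c z).card ≤ j})),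
      (((1 - ((w s(u, c) : ℝ) * (w s(u, a') : ℝ))) * (((w s(v, b) : ℝ) * w s(v, b')) * (1 - (w s(u, a') : ℝ)) / 2) * ((1 - ((w s(u, c) : ℝ) * (w s(u, a') : ℝ))) * ((w s(v, b) : ℝ) * w s(v, b')))), ((fun ω : BondConfig (Fin n) => insert s(v, b) (insert s(v, b') ω)) ⁻¹' {ω : BondConfig (Fin n) | (A.filter fun z => ω ∈ openConn b' z).card ≤ j})),
      ((-((1 - ((w s(u, c) : ℝ) * (w s(u, a') : ℝ))) * (((w s(v, b) : ℝ) * w s(v, b')) * (1 - (w s(u, a') : ℝ)) / 2) * (((w s(u, c) : ℝ) * (w s(u, a') : ℝ)) * (1 - ((w s(v, b) : ℝ) * w s(v, b')))))), ((fun ω : BondConfig (Fin n) => insert s(u, c) (insert s(u, a') ω)) ⁻¹' {ω : BondConfig (Fin n) | (A.filter fun z => ω ∈ openConn c z).card ≤ j})),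
      (((1 - ((w s(u, c) : ℝ) * (w s(u, a') : ℝ))) * (((w s(v, b) : ℝ) * w s(v, b')) * (1 - (w s(u, a') : ℝ)) / 2) * (((w s(u, c) : ℝ) * (w s(u, a') : ℝ)) * (1 - ((w s(v, b) : ℝ) * w s(v, b'))))), ((fun ω : BondConfig (Fin n) => insert s(u, c) (insert s(u, a') ω)) ⁻¹' {ω : BondConfig (Fin n) | (A.filter fun z => ω ∈ openConn b' z).card ≤ j})),
      ((-((1 - ((w s(u, c) : ℝ) * (w s(u, a') : ℝ))) * (((w s(v, b) : ℝ) * w s(v, b')) * (1 - (w s(u, a') : ℝ)) / 2) * (((w s(u, c) : ℝ) * (w s(u, a') : ℝ)) * ((w s(v, b) : ℝ) * w s(v, b'))))), ((fun ω : BondConfig (Fin n) => insert s(u, c) (insert s(u, a') (insert s(v, b) (insert s(v, b') ω)))) ⁻¹' {ω : BondConfig (Fin n) | (A.filter fun z => ω ∈ openConn c z).card ≤ j})),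
      (((1 - ((w s(u, c) : ℝ) * (w s(u, a') : ℝ))) * (((w s(v, b) : ℝ) * w s(v, b')) * (1 - (w s(u, a') : ℝ)) / 2) * (((w s(u, c) : ℝ) * (w s(u, a') : ℝ)) * ((w s(v, b) : ℝ) * w s(v, b')))), ((fun ω : BondConfig (Fin n) => insert s(u, c) (insert s(u, a') (insert s(v, b) (insert s(v, b') ω)))) ⁻¹' {ω : BondConfig (Fin n) | (A.filter fun z => ω ∈ openConn b' z).card ≤ j}))] : List (ℝ × Set (BondConfig (Fin n)))).map
      fun ce => ce.1 * ce.2.indicator (1 : BondConfig (Fin n) → ℝ) ω).sum := by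
  have hN := prodBernoulli_setOf_exists_mem_eq_zero (Function.update (Function.update (Function.update (Function.update w s(v, b) 0) s(v, b') 0) s(u, c) 0) s(u, a') 0) _
    (hubPairs_weight_zero w A u v c a' b b' hu hv huv hc ha' hb hb' hca' hbb' hutwo hvtwo)
  rw [ae_iff]
  refine measure_mono_null (fun ω hω => ?_) hN
  simp only [Set.mem_setOf_eq] at hω ⊢
  by_contra hnot
  apply hω
  have hisoU : ∀ y : Fin n, y ≠ u → s(u, y) ∉ ω := fun y hy h =>
    hnot ⟨s(u, y), Finset.mem_union_left _ (Finset.mem_image.2 ⟨y, Finset.mem_filter.2 ⟨Finset.mem_univ _, hy⟩, rfl⟩), h⟩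
  have hisoV : ∀ y : Fin n, y ≠ v → s(v, y) ∉ ω := fun y hy h =>
    hnot ⟨s(v, y), Finset.mem_union_right _ (Finset.mem_image.2 ⟨y, Finset.mem_filter.2 ⟨Finset.mem_univ _, hy⟩, rfl⟩), h⟩
  exact cport_certificate_at w A u v c a' b b' j hj hu hv huv hc ha' hb hb' hca' hcb hcb' ha'b ha'b' hbb' ω hisoU hisoV

/-- **The champion-at-a-port certificate integrated (level `j ≤ 2`).**  `u = {c, a'}` with bond weights `a_c, a'`,
`v = {b, b'}` with `θ_v = w(vb)w(vb')`, hubs `u, v ∉ A` carrying no other open pair, `c, a', b, b' ∈ A` pairwise distinct,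
`j ≤ 2`; if `P_w(R_x) ≤ P_w(R_c)` for `x ∈ {a', b, b'}` then `0 ≤ (1 − a_c a')·[(1 − a')·h00 + a'·h01]`, where
`h00 = (1−θ_v)(P₀₀₀(R_c) − P₀₀₀(L_u)) + θ_v(P_V(ρ) − P_V(ℓ))` (hubs closed / `v` glued) and `h01` the same with the pendant
bond `ua'` open — the measure form of `E[Z] ≥ 0` of memo §9. [this file; memo TWO-PORT-PEELING.md §9] -/
theorem cport_nonneg_levelTwo (w : Sym2 (Fin n) → unitInterval) (A : Finset (Fin n))
    (u v c a' b b' : Fin n) (j : ℕ) (hj : j ≤ 2) (hu : u ∉ A) (hv : v ∉ A) (huv : u ≠ v)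
    (hc : c ∈ A) (ha' : a' ∈ A) (hb : b ∈ A) (hb' : b' ∈ A)
    (hca' : c ≠ a') (hcb : c ≠ b) (hcb' : c ≠ b') (ha'b : a' ≠ b) (ha'b' : a' ≠ b') (hbb' : b ≠ b')
    (hutwo : ∀ y : Fin n, y ≠ u → y ≠ c → y ≠ a' → w s(u, y) = 0)
    (hvtwo : ∀ y : Fin n, y ≠ v → y ≠ b → y ≠ b' → w s(v, y) = 0)
    (hKa : (prodBernoulli w).real {ω : BondConfig (Fin n) | (A.filter fun z => ω ∈ openConn a' z).card ≤ j} ≤ (prodBernoulli w).real {ω : BondConfig (Fin n) | (A.filter fun z => ω ∈ openConn c z).card ≤ j})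
    (hKb : (prodBernoulli w).real {ω : BondConfig (Fin n) | (A.filter fun z => ω ∈ openConn b z).card ≤ j} ≤ (prodBernoulli w).real {ω : BondConfig (Fin n) | (A.filter fun z => ω ∈ openConn c z).card ≤ j})
    (hKb' : (prodBernoulli w).real {ω : BondConfig (Fin n) | (A.filter fun z => ω ∈ openConn b' z).card ≤ j} ≤ (prodBernoulli w).real {ω : BondConfig (Fin n) | (A.filter fun z => ω ∈ openConn c z).card ≤ j}) :
    0 ≤ (1 - ((w s(u, c) : ℝ) * (w s(u, a') : ℝ))) * ((1 - (w s(u, a') : ℝ)) * ((1 - ((w s(v, b) : ℝ) * w s(v, b'))) * ((prodBernoulli (Function.update (Function.update (Function.update (Function.update w s(v, b) 0) s(v, b') 0) s(u, c) 0) s(u, a') 0)).real {ω : BondConfig (Fin n) | (A.filter fun z => ω ∈ openConn c z).card ≤ j} - (prodBernoulli (Function.update (Function.update (Function.update (Function.update w s(v, b) 0) s(v, b') 0) s(u, c) 0) s(u, a') 0)).real {ω : BondConfig (Fin n) | 1 ≤ (A.filter fun z => ω ∈ openConn u z).card ∧ (A.filter fun z => ω ∈ openConn u z).card ≤ j}) +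 ((w s(v, b) : ℝ) * w s(v, b')) * ((prodBernoulli (Function.update (Function.update (Function.update (Function.update w s(v, b) 1) s(v, b') 1) s(u, c) 0) s(u, a') 0)).real {ω : BondConfig (Fin n) | ω ∉ openConn c u ∧ ω ∉ openConn c v ∧ (A.filter fun z => ω ∈ openConn c z).card ≤ j} - (prodBernoulli (Function.update (Function.update (Function.update (Function.update w s(v, b) 1) s(v, b') 1) s(u, c) 0) s(u, a') 0)).real {ω : BondConfig (Fin n) | ω ∉ openConn c u ∧ ω ∉ openConn c v ∧ 1 ≤ (A.filter fun z => ω ∈ openConn u z ∨ ω ∈ openConn v z).card ∧ (A.filter fun z => ω ∈ openConn u z ∨ ω ∈ openConn v z).card ≤ j})) +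
      (w s(u, a') : ℝ) * ((1 - ((w s(v, b) : ℝ) * w s(v, b'))) * ((prodBernoulli (Function.update (Function.update (Function.update (Function.update w s(v, b) 0) s(v, b') 0) s(u, c) 0) s(u, a') 1)).real {ω : BondConfig (Fin n) | (A.filter fun z => ω ∈ openConn c z).card ≤ j} - (prodBernoulli (Function.update (Function.update (Function.update (Function.update w s(v, b) 0) s(v, b') 0) s(u, c) 0) s(u, a') 1)).real {ω : BondConfig (Fin n) | 1 ≤ (A.filter fun z => ω ∈ openConn u z).card ∧ (A.filter fun z => ω ∈ openConn u z).card ≤ j}) + ((w s(v, b) : ℝ) * w s(v, b')) * ((prodBernoulli (Function.update (Function.update (Function.update (Function.update w s(v, b) 1) s(v, b') 1) s(u, c) 0) s(u, a') 1)).real {ω : BondConfig (Fin n) | ω ∉ openConn c u ∧ ω ∉ openConn c v ∧ (A.filter fun z => ω ∈ openConn c z).card ≤ j} - (prodBernoulli (Function.update (Function.update (Function.update (Function.update w s(v, b) 1) s(v, b') 1) s(u, c) 0) s(u, a') 1)).real {ω : BondConfig (Fin n) | ω ∉ openConn c u ∧ ω ∉ openConn c v ∧ 1 ≤ (A.filter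 fun z => ω ∈ openConn u z ∨ ω ∈ openConn v z).card ∧ (A.filter fun z => ω ∈ openConn u z ∨ ω ∈ openConn v z).card ≤ j}))) := by
  have huc : u ≠ c := fun h => hu (h ▸ hc)
  have hua' : u ≠ a' := fun h => hu (h ▸ ha')
  have hub : u ≠ b := fun h => hu (h ▸ hb)
  have hub' : u ≠ b' := fun h => hu (h ▸ hb')
  have hvc : v ≠ c := fun h => hv (h ▸ hc)
  have hva' : v ≠ a' := fun h => hv (h ▸ ha')
  have hvb : v ≠ b := fun h => hv (h ▸ hb)
  have hvb' : v ≠ b' := fun h => hv (h ▸ hb')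
  have png : ∀ {p q r t : Fin n}, (p ≠ r ∨ q ≠ t) → (p ≠ t ∨ q ≠ r) → (s(p, q) : Sym2 (Fin n)) ≠ s(r, t) := by
    intro p q r t h1 h2 h
    rw [Sym2.eq_iff] at h
    rcases h with ⟨h3, h4⟩ | ⟨h3, h4⟩
    · rcases h1 with h1 | h1
      · exact h1 h3
      · exact h1 h4
    · rcases h2 with h2 | h2
      · exact h2 h3
      · exact h2 h4
  have nUA : (s(u, c) : Sym2 (Fin n)) ≠ s(u, a') := png (Or.inr hca') (Or.inl hua')
  have nVB : (s(v, b) : Sym2 (Fin n)) ≠ s(v, b') := png (Or.inr hbb') (Or.inl hvb')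
  have nAB : (s(u, c) : Sym2 (Fin n)) ≠ s(v, b) := png (Or.inl huv) (Or.inl hub)
  have nAB' : (s(u, c) : Sym2 (Fin n)) ≠ s(v, b') := png (Or.inl huv) (Or.inl hub')
  have nA'B : (s(u, a') : Sym2 (Fin n)) ≠ s(v, b) := png (Or.inl huv) (Or.inl hub)
  have nA'B' : (s(u, a') : Sym2 (Fin n)) ≠ s(v, b') := png (Or.inl huv) (Or.inl hub')
  have nUyB : ∀ y : Fin n, (s(u, y) : Sym2 (Fin n)) ≠ s(v, b) := fun y => png (Or.inl huv) (Or.inl hub)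
  have nUyB' : ∀ y : Fin n, (s(u, y) : Sym2 (Fin n)) ≠ s(v, b') := fun y => png (Or.inl huv) (Or.inl hub')
  have hp0 : 0 ≤ (w s(u, c) : ℝ) := (w s(u, c)).2.1
  have hp1 : (w s(u, c) : ℝ) ≤ 1 := (w s(u, c)).2.2
  have hq0 : 0 ≤ (w s(u, a') : ℝ) := (w s(u, a')).2.1
  have hq1 : (w s(u, a') : ℝ) ≤ 1 := (w s(u, a')).2.2
  have hs0 : 0 ≤ ((w s(v, b) : ℝ) * w s(v, b')) := mul_nonneg (w s(v, b)).2.1 (w s(v, b')).2.1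
  have hs1 : ((w s(v, b) : ℝ) * w s(v, b')) ≤ 1 := mul_le_one₀ (w s(v, b)).2.2 (w s(v, b')).2.1 (w s(v, b')).2.2
  have hτ0 : 0 ≤ ((w s(u, c) : ℝ) * (w s(u, a') : ℝ)) := mul_nonneg hp0 hq0
  have hτ1 : ((w s(u, c) : ℝ) * (w s(u, a') : ℝ)) ≤ 1 := mul_le_one₀ hp1 hq0 hq1
  have hutwo0 : ∀ y : Fin n, y ≠ u → y ≠ c → y ≠ a' →
      Function.update (Function.update w s(v, b) 0) s(v, b') 0 s(u, y) = 0 := by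
    intro y hy hyc hya'
    rw [Function.update_of_ne (nUyB' y), Function.update_of_ne (nUyB y)]
    exact hutwo y hy hyc hya'
  have hutwo1 : ∀ y : Fin n, y ≠ u → y ≠ c → y ≠ a' →
      Function.update (Function.update w s(v, b) 1) s(v, b') 1 s(u, y) = 0 := by
    intro y hy hyc hya'
    rw [Function.update_of_ne (nUyB' y), Function.update_of_ne (nUyB y)]
    exact hutwo y hy hyc hya'
  have hwc0 : Function.update (Function.update w s(v, b) 0) s(v, b') 0 s(u, c) = w s(u, c) := by
    rw [Function.update_of_ne nAB', Function.update_of_ne nAB]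
  have hwa'0 : Function.update (Function.update w s(v, b) 0) s(v, b') 0 s(u, a') = w s(u, a') := by
    rw [Function.update_of_ne nA'B', Function.update_of_ne nA'B]
  have hwc1 : Function.update (Function.update w s(v, b) 1) s(v, b') 1 s(u, c) = w s(u, c) := by
    rw [Function.update_of_ne nAB', Function.update_of_ne nAB]
  have hwa'1 : Function.update (Function.update w s(v, b) 1) s(v, b') 1 s(u, a') = w s(u, a') := by
    rw [Function.update_of_ne nA'B', Function.update_of_ne nA'B]
  have e1c := relay_law_eq w A c j hv hbb' hvb.symm hvb'.symm hvc.symm hvtwo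
  have e2c := relay_law_eq (Function.update (Function.update w s(v, b) 0) s(v, b') 0) A c j hu hca' huc.symm hua'.symm huc.symm hutwo0
  have e3c := relay_law_eq (Function.update (Function.update w s(v, b) 1) s(v, b') 1) A c j hu hca' huc.symm hua'.symm huc.symm hutwo1
  rw [hwc0, hwa'0] at e2c
  rw [hwc1, hwa'1] at e3c
  rw [e2c, e3c] at e1c
  have e1ap := relay_law_eq w A a' j hv hbb' hvb.symm hvb'.symm hva'.symm hvtwo
  have e2ap := relay_law_eq (Function.update (Function.update w s(v, b) 0) s(v, b') 0) A a' j hu hca' huc.symm hua'.symm hua'.symm hutwo0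
  have e3ap := relay_law_eq (Function.update (Function.update w s(v, b) 1) s(v, b') 1) A a' j hu hca' huc.symm hua'.symm hua'.symm hutwo1
  rw [hwc0, hwa'0] at e2ap
  rw [hwc1, hwa'1] at e3ap
  rw [e2ap, e3ap] at e1ap
  have e1b := relay_law_eq w A b j hv hbb' hvb.symm hvb'.symm hvb.symm hvtwo
  have e2b := relay_law_eq (Function.update (Function.update w s(v, b) 0) s(v, b') 0) A b j hu hca' huc.symm hua'.symm hub.symm hutwo0
  have e3b := relay_law_eq (Function.update (Function.update w s(v, b) 1) s(v, b') 1) A b j hu hca' huc.symm hua'.symm hub.symm hutwo1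
  rw [hwc0, hwa'0] at e2b
  rw [hwc1, hwa'1] at e3b
  rw [e2b, e3b] at e1b
  have e1bp := relay_law_eq w A b' j hv hbb' hvb.symm hvb'.symm hvb'.symm hvtwo
  have e2bp := relay_law_eq (Function.update (Function.update w s(v, b) 0) s(v, b') 0) A b' j hu hca' huc.symm hua'.symm hub'.symm hutwo0
  have e3bp := relay_law_eq (Function.update (Function.update w s(v, b) 1) s(v, b') 1) A b' j hu hca' huc.symm hua'.symm hub'.symm hutwo1
  rw [hwc0, hwa'0] at e2bp
  rw [hwc1, hwa'1] at e3bp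
  rw [e2bp, e3bp] at e1bp
  have PG : ∀ S : Set (BondConfig (Fin n)), (prodBernoulli (Function.update (Function.update (Function.update (Function.update w s(v, b) 0) s(v, b') 0) s(u, c) 1) s(u, a') 1)).real S =
      (prodBernoulli (Function.update (Function.update (Function.update (Function.update w s(v, b) 0) s(v, b') 0) s(u, c) 0) s(u, a') 0)).real ((fun ω : BondConfig (Fin n) => insert s(u, c) (insert s(u, a') ω)) ⁻¹' S) := fun S =>
    real_update_two_pull (Function.update (Function.update w s(v, b) 0) s(v, b') 0) nUA S
  have PV : ∀ S : Set (BondConfig (Fin n)), (prodBernoulli (Function.update (Function.update (Function.update (Function.update w s(v, b) 1) s(v, b') 1) s(u, c) 0) s(u, a') 0)).real S =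
      (prodBernoulli (Function.update (Function.update (Function.update (Function.update w s(v, b) 0) s(v, b') 0) s(u, c) 0) s(u, a') 0)).real ((fun ω : BondConfig (Fin n) => insert s(v, b) (insert s(v, b') ω)) ⁻¹' S) := fun S => by
    rw [update_comm4 w nAB.symm nA'B.symm nAB'.symm nA'B'.symm 1 1 0 0,
      real_update_two_pull (Function.update (Function.update w s(u, c) 0) s(u, a') 0) nVB S,
      update_comm4 w nAB nAB' nA'B nA'B' 0 0 0 0]
  have PP : ∀ S : Set (BondConfig (Fin n)), (prodBernoulli (Function.update (Function.update (Function.update (Function.update w s(v, b) 0) s(v, b') 0) s(u, c) 0) s(u, a') 1)).real S =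
      (prodBernoulli (Function.update (Function.update (Function.update (Function.update w s(v, b) 0) s(v, b') 0) s(u, c) 0) s(u, a') 0)).real ((fun ω : BondConfig (Fin n) => insert s(u, a') ω) ⁻¹' S) := fun S =>
    tieLiftOne_real_one_eq (Function.update (Function.update (Function.update w s(v, b) 0) s(v, b') 0) s(u, c) 0) s(u, a') S
  have PPV : ∀ S : Set (BondConfig (Fin n)), (prodBernoulli (Function.update (Function.update (Function.update (Function.update w s(v, b) 1) s(v, b') 1) s(u, c) 0) s(u, a') 1)).real S =
      (prodBernoulli (Function.update (Function.update (Function.update (Function.update w s(v, b) 0) s(v, b') 0) s(u, c) 0) s(u, a') 0)).real ((fun ω : BondConfig (Fin n) => insert s(u, a') (insert s(v, b) (insert s(v, b') ω))) ⁻¹' S) := fun S => by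
    rw [tieLiftOne_real_one_eq (Function.update (Function.update (Function.update w s(v, b) 1) s(v, b') 1) s(u, c) 0) s(u, a') S, PV]
    rfl
  have PGV : ∀ S : Set (BondConfig (Fin n)), (prodBernoulli (Function.update (Function.update (Function.update (Function.update w s(v, b) 1) s(v, b') 1) s(u, c) 1) s(u, a') 1)).real S =
      (prodBernoulli (Function.update (Function.update (Function.update (Function.update w s(v, b) 0) s(v, b') 0) s(u, c) 0) s(u, a') 0)).real ((fun ω : BondConfig (Fin n) => insert s(u, c) (insert s(u, a') (insert s(v, b) (insert s(v, b') ω)))) ⁻¹' S) := fun S => by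
    rw [real_update_two_pull (Function.update (Function.update w s(v, b) 1) s(v, b') 1) nUA S, PV]
    rfl
  have hKa'' : 0 ≤ ((1 - ((w s(v, b) : ℝ) * w s(v, b'))) * ((1 - ((w s(u, c) : ℝ) * (w s(u, a') : ℝ))) * (prodBernoulli (Function.update (Function.update (Function.update (Function.update w s(v, b) 0) s(v, b') 0) s(u, c) 0) s(u, a') 0)).real {ω : BondConfig (Fin n) | (A.filter fun z => ω ∈ openConn c z).card ≤ j} + ((w s(u, c) : ℝ) * (w s(u, a') : ℝ)) * (prodBernoulli (Function.update (Function.update (Function.update (Function.update w s(v, b) 0) s(v, b') 0) s(u, c) 0) s(u, a') 0)).real ((fun ω : BondConfig (Fin n) => insert s(u, c) (insert s(u, a') ω)) ⁻¹' {ω : BondConfig (Fin n) | (A.filter fun z => ω ∈ openConn c z).card ≤ j})) + ((w s(v, b) : ℝ) * w s(v, b')) * ((1 - ((w s(u, c) : ℝ) * (w s(u, a') : ℝ))) * (prodBernoulli (Function.update (Function.update (Function.update (Function.update w s(v, b) 0) s(v, b') 0) s(u, c) 0) s(u, a') 0)).real ((fun ω : BondConfig (Fin n) => insert s(v, b) (insert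 s(v, b') ω)) ⁻¹' {ω : BondConfig (Fin n) | (A.filter fun z => ω ∈ openConn c z).card ≤ j}) + ((w s(u, c) : ℝ) * (w s(u, a') : ℝ)) * (prodBernoulli (Function.update (Function.update (Function.update (Function.update w s(v, b) 0) s(v, b') 0) s(u, c) 0) s(u, a') 0)).real ((fun ω : BondConfig (Fin n) => insert s(u, c) (insert s(u, a') (insert s(v, b) (insert s(v, b') ω)))) ⁻¹' {ω : BondConfig (Fin n) | (A.filter fun z => ω ∈ openConn c z).card ≤ j}))) -
      ((1 - ((w s(v, b) : ℝ) * w s(v, b'))) * ((1 - ((w s(u, c) : ℝ) * (w s(u, a') : ℝ))) * (prodBernoulli (Function.update (Function.update (Function.update (Function.update w s(v, b) 0) s(v, b') 0) s(u, c) 0) s(u, a') 0)).real {ω : BondConfig (Fin n) | (A.filter fun z => ω ∈ openConn a' z).card ≤ j} + ((w s(u, c) : ℝ) * (w s(u, a') : ℝ)) * (prodBernoulli (Function.update (Function.update (Function.update (Function.update w s(v, b) 0) s(v, b') 0) s(u, c) 0) s(u, a') 0)).real ((fun ω : BondConfig (Fin n) => insert s(u, c) (insert s(u, a') ω)) ⁻¹'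 {ω : BondConfig (Fin n) | (A.filter fun z => ω ∈ openConn a' z).card ≤ j})) + ((w s(v, b) : ℝ) * w s(v, b')) * ((1 - ((w s(u, c) : ℝ) * (w s(u, a') : ℝ))) * (prodBernoulli (Function.update (Function.update (Function.update (Function.update w s(v, b) 0) s(v, b') 0) s(u, c) 0) s(u, a') 0)).real ((fun ω : BondConfig (Fin n) => insert s(v, b) (insert s(v, b') ω)) ⁻¹' {ω : BondConfig (Fin n) | (A.filter fun z => ω ∈ openConn a' z).card ≤ j}) + ((w s(u, c) : ℝ) * (w s(u, a') : ℝ)) * (prodBernoulli (Function.update (Function.update (Function.update (Function.update w s(v, b) 0) s(v, b') 0) s(u, c) 0) s(u, a') 0)).real ((fun ω : BondConfig (Fin n) => insert s(u, c) (insert s(u, a') (insert s(v, b) (insert s(v, b') ω)))) ⁻¹' {ω : BondConfig (Fin n) | (A.filter fun z => ω ∈ openConn a' z).card ≤ j}))) := by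
    have h := sub_nonneg.2 hKa
    rw [e1c, e1ap, PG, PG, PV, PV, PGV, PGV] at h
    linarith
  have hKb'' : 0 ≤ ((1 - ((w s(v, b) : ℝ) * w s(v, b'))) * ((1 - ((w s(u, c) : ℝ) * (w s(u, a') : ℝ))) * (prodBernoulli (Function.update (Function.update (Function.update (Function.update w s(v, b) 0) s(v, b') 0) s(u, c) 0) s(u, a') 0)).real {ω : BondConfig (Fin n) | (A.filter fun z => ω ∈ openConn c z).card ≤ j} + ((w s(u, c) : ℝ) * (w s(u, a') : ℝ)) * (prodBernoulli (Function.update (Function.update (Function.update (Function.update w s(v, b) 0) s(v, b') 0) s(u, c) 0) s(u, a') 0)).real ((fun ω : BondConfig (Fin n) => insert s(u, c) (insert s(u, a') ω)) ⁻¹' {ω : BondConfig (Fin n) | (A.filter fun z => ω ∈ openConn c z).card ≤ j})) + ((w s(v, b) : ℝ) * w s(v, b')) * ((1 - ((w s(u, c) : ℝ) * (w s(u, a') : ℝ))) * (prodBernoulli (Function.update (Function.update (Function.update (Function.update w s(v, b) 0) s(v, b') 0) s(u, c) 0) s(u, a') 0)).real ((fun ω : BondConfig (Fin n) => insert s(v,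 b) (insert s(v, b') ω)) ⁻¹' {ω : BondConfig (Fin n) | (A.filter fun z => ω ∈ openConn c z).card ≤ j}) + ((w s(u, c) : ℝ) * (w s(u, a') : ℝ)) * (prodBernoulli (Function.update (Function.update (Function.update (Function.update w s(v, b) 0) s(v, b') 0) s(u, c) 0) s(u, a') 0)).real ((fun ω : BondConfig (Fin n) => insert s(u, c) (insert s(u, a') (insert s(v, b) (insert s(v, b') ω)))) ⁻¹' {ω : BondConfig (Fin n) | (A.filter fun z => ω ∈ openConn c z).card ≤ j}))) -
      ((1 - ((w s(v, b) : ℝ) * w s(v, b'))) * ((1 - ((w s(u, c) : ℝ) * (w s(u, a') : ℝ))) * (prodBernoulli (Function.update (Function.update (Function.update (Function.update w s(v, b) 0) s(v, b') 0) s(u, c) 0) s(u, a') 0)).real {ω : BondConfig (Fin n) | (A.filter fun z => ω ∈ openConn b z).card ≤ j} + ((w s(u, c) : ℝ) * (w s(u, a') : ℝ)) * (prodBernoulli (Function.update (Function.update (Function.update (Function.update w s(v, b) 0) s(v, b') 0) s(u, c) 0) s(u, a') 0)).real ((fun ω : BondConfig (Fin n) => insert s(u, c) (insert s(u, a') ω))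 ⁻¹' {ω : BondConfig (Fin n) | (A.filter fun z => ω ∈ openConn b z).card ≤ j})) + ((w s(v, b) : ℝ) * w s(v, b')) * ((1 - ((w s(u, c) : ℝ) * (w s(u, a') : ℝ))) * (prodBernoulli (Function.update (Function.update (Function.update (Function.update w s(v, b) 0) s(v, b') 0) s(u, c) 0) s(u, a') 0)).real ((fun ω : BondConfig (Fin n) => insert s(v, b) (insert s(v, b') ω)) ⁻¹' {ω : BondConfig (Fin n) | (A.filter fun z => ω ∈ openConn b z).card ≤ j}) + ((w s(u, c) : ℝ) * (w s(u, a') : ℝ)) * (prodBernoulli (Function.update (Function.update (Function.update (Function.update w s(v, b) 0) s(v, b') 0) s(u, c) 0) s(u, a') 0)).real ((fun ω : BondConfig (Fin n) => insert s(u, c) (insert s(u, a') (insert s(v, b) (insert s(v, b') ω)))) ⁻¹' {ω : BondConfig (Fin n) | (A.filter fun z => ω ∈ openConn b z).card ≤ j}))) := by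
    have h := sub_nonneg.2 hKb
    rw [e1c, e1b, PG, PG, PV, PV, PGV, PGV] at h
    linarith
  have hKbp'' : 0 ≤ ((1 - ((w s(v, b) : ℝ) * w s(v, b'))) * ((1 - ((w s(u, c) : ℝ) * (w s(u, a') : ℝ))) * (prodBernoulli (Function.update (Function.update (Function.update (Function.update w s(v, b) 0) s(v, b') 0) s(u, c) 0) s(u, a') 0)).real {ω : BondConfig (Fin n) | (A.filter fun z => ω ∈ openConn c z).card ≤ j} + ((w s(u, c) : ℝ) * (w s(u, a') : ℝ)) * (prodBernoulli (Function.update (Function.update (Function.update (Function.update w s(v, b) 0) s(v, b') 0) s(u, c) 0) s(u, a') 0)).real ((fun ω : BondConfig (Fin n) => insert s(u, c) (insert s(u, a') ω)) ⁻¹' {ω : BondConfig (Fin n) | (A.filter fun z => ω ∈ openConn c z).card ≤ j})) + ((w s(v, b) : ℝ) * w s(v, b')) * ((1 - ((w s(u, c) : ℝ) * (w s(u, a') : ℝ))) * (prodBernoulli (Function.update (Function.update (Function.update (Function.update w s(v, b) 0) s(v, b') 0) s(u, c) 0) s(u, a') 0)).real ((fun ω : BondConfig (Fin n) => insert s(v,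 b) (insert s(v, b') ω)) ⁻¹' {ω : BondConfig (Fin n) | (A.filter fun z => ω ∈ openConn c z).card ≤ j}) + ((w s(u, c) : ℝ) * (w s(u, a') : ℝ)) * (prodBernoulli (Function.update (Function.update (Function.update (Function.update w s(v, b) 0) s(v, b') 0) s(u, c) 0) s(u, a') 0)).real ((fun ω : BondConfig (Fin n) => insert s(u, c) (insert s(u, a') (insert s(v, b) (insert s(v, b') ω)))) ⁻¹' {ω : BondConfig (Fin n) | (A.filter fun z => ω ∈ openConn c z).card ≤ j}))) -
      ((1 - ((w s(v, b) : ℝ) * w s(v, b'))) * ((1 - ((w s(u, c) : ℝ) * (w s(u, a') : ℝ))) * (prodBernoulli (Function.update (Function.update (Function.update (Function.update w s(v, b) 0) s(v, b') 0) s(u, c) 0) s(u, a') 0)).real {ω : BondConfig (Fin n) | (A.filter fun z => ω ∈ openConn b' z).card ≤ j} + ((w s(u, c) : ℝ) * (w s(u, a') : ℝ)) * (prodBernoulli (Function.update (Function.update (Function.update (Function.update w s(v, b) 0) s(v, b') 0) s(u, c) 0) s(u, a') 0)).real ((fun ω : BondConfig (Fin n) => insert s(u, c) (insert s(u, a') ω))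 ⁻¹' {ω : BondConfig (Fin n) | (A.filter fun z => ω ∈ openConn b' z).card ≤ j})) + ((w s(v, b) : ℝ) * w s(v, b')) * ((1 - ((w s(u, c) : ℝ) * (w s(u, a') : ℝ))) * (prodBernoulli (Function.update (Function.update (Function.update (Function.update w s(v, b) 0) s(v, b') 0) s(u, c) 0) s(u, a') 0)).real ((fun ω : BondConfig (Fin n) => insert s(v, b) (insert s(v, b') ω)) ⁻¹' {ω : BondConfig (Fin n) | (A.filter fun z => ω ∈ openConn b' z).card ≤ j}) + ((w s(u, c) : ℝ) * (w s(u, a') : ℝ)) * (prodBernoulli (Function.update (Function.update (Function.update (Function.update w s(v, b) 0) s(v, b') 0) s(u, c) 0) s(u, a') 0)).real ((fun ω : BondConfig (Fin n) => insert s(u, c) (insert s(u, a') (insert s(v, b) (insert s(v, b') ω)))) ⁻¹' {ω : BondConfig (Fin n) | (A.filter fun z => ω ∈ openConn b' z).card ≤ j}))) := by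
    have h := sub_nonneg.2 hKb'
    rw [e1c, e1bp, PG, PG, PV, PV, PGV, PGV] at h
    linarith
  have hint := lincomb_nonneg_of_ae (Function.update (Function.update (Function.update (Function.update w s(v, b) 0) s(v, b') 0) s(u, c) 0) s(u, a') 0) _
    (cport_certificate_ae w A u v c a' b b' j hj hu hv huv hc ha' hb hb' hca' hcb hcb' ha'b ha'b' hbb' hutwo hvtwo)
  simp only [List.map_cons, List.map_nil, List.sum_cons, List.sum_nil] at hint
  rw [PV {ω : BondConfig (Fin n) | ω ∉ openConn c u ∧ ω ∉ openConn c v ∧ (A.filter fun z => ω ∈ openConn c z).card ≤ j}, PV {ω : BondConfig (Fin n) | ω ∉ openConn c u ∧ ω ∉ openConn c v ∧ 1 ≤ (A.filter fun z => ω ∈ openConn u z ∨ ω ∈ openConn v z).card ∧ (A.filter fun z => ω ∈ openConn u z ∨ ω ∈ openConn v z).card ≤ j}, PP {ω : BondConfig (Fin n) | (A.filter fun z => ω ∈ openConn c z).card ≤ j}, PP {ω : BondConfig (Fin n) | 1 ≤ (A.filter fun z => ω ∈ openConn u z).card ∧ (A.filter fun z => ω ∈ openConn u z).card ≤ j}, PPV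 {ω : BondConfig (Fin n) | ω ∉ openConn c u ∧ ω ∉ openConn c v ∧ (A.filter fun z => ω ∈ openConn c z).card ≤ j}, PPV {ω : BondConfig (Fin n) | ω ∉ openConn c u ∧ ω ∉ openConn c v ∧ 1 ≤ (A.filter fun z => ω ∈ openConn u z ∨ ω ∈ openConn v z).card ∧ (A.filter fun z => ω ∈ openConn u z ∨ ω ∈ openConn v z).card ≤ j}]
  have h1τ : 0 ≤ 1 - ((w s(u, c) : ℝ) * (w s(u, a') : ℝ)) := sub_nonneg.2 hτ1
  have hlam0 : 0 ≤ (((w s(v, b) : ℝ) * w s(v, b')) * (1 - (w s(u, a') : ℝ)) / 2) := by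
    have := mul_nonneg hs0 (sub_nonneg.2 hq1)
    linarith
  linarith [hint, mul_nonneg hq0 hKa'', mul_nonneg (mul_nonneg h1τ hlam0) hKb'', mul_nonneg (mul_nonneg h1τ hlam0) hKbp'']

end TwoPortPeeling

end Summit.CriticalPhenomena.PercolationContinuityZ3.Theorems
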